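import Summits.AtomisticToContinuum.Crystallization.Theorems.ChargedEnergyGapResidualSF
import HarnessLib

/-!
# Charged energy gap — lens-3 g64, node «BarlowRef» (R3): the designate pair re-typed over BARLOW-IMAGE references

Cell `decomp-a2c`, seat lens-3, generation 64, part P-N‴ (over part P-Z₅⁰ `…Theorems.ChargedEnergyGapResidualSF`).  ELEMENTARY·PROVED
(definitions, order lemmas, record cones, the chain to the bulk residual, the witness); 0 sorry; standard axioms.

WHY (the g64 feasibility audit, memo g64 §1; critic rows 1188 (C), 1191 (B)).  The 14231 residual of record after generation 63 is
`BulkFarResidueBoundSF (3/5) (1/3) 3 (1/100) 160 80 (1/2100) (1/46) B_H`: the bulk far residue charged to shell mass, transition mass and the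
priced-near count with budgets `(B_T, B_χ) = (1/2100, 1/46)`.  Every charging scheme the seat can certify pays the LOAD of a carrier `c`
(`Σ_{pairs (y, z) routed through c} |y − z|⁻⁶ / #carriers(y, z)`) from `B_T`; the load is `∝ ρ_src·ρ_tgt` and the carrier count `∝ ρ_carriers`,
and under the record reference hypotheses `(s, lam, ℓ) = (3/5, 1/3, 3)` the only certified bounds are the ball count `ρ ≤ 8.84` (separation
`3/5`) against the labelled-patch floor `109` sites per `6.19`-ball (`≈ 0.11` per unit volume): a density CONTRAST of `≈ 80` that no admissible
reference realises (the references the reduction (N𝄪ˢ) actually presents are fcc / hcp supercells) but that the three physical hypotheses do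
not cheaply exclude either (the site virial only caps the nearest-neighbour distance from below by `≈ 0.75`).  With the isotropic tube kernel
`4π²r²ρ²/(6(a₀+b₀)²)` the worst-case load/`B_T` ratio of the generation-63 scheme «6 × 109» is `13–24` (slab calibration `0.3–0.54` BEFORE the
discretisation slop) — not provable as dimensioned; whereas with the reference pinned to a BARLOW IMAGE (lattice constant `a ∈ [9/10, 11/10]`,
layer spacing `h ∈ [0.66a, 0.90a]`, density `∈ [0.966, 2.16]`, exact layer coordinates) the same kernel against exact block counts gives
`0.06–0.31` at block radius `18–39` in the worst isotropic geometry and `0.004–0.06` in the slab / pays-to-the-floor geometries (memo g64 §1, table).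

THE MOVE (lens «one certified translation + split beneath», third re-typing after (R1) μ-gauge and (R2) site-stress): ADD ONE BINDER
`IsBarlowImage P.points` (the tree's predicate, `…CoherenceDial` §1, window included) to the reference block of the designate pair, leaving all
twelve dials and the conclusion verbatim:
* §R1 `labelledWithin_of_isBarlowImage`, `isLabelledRef_of_isBarlowImage` — a Barlow image is `(lam, ℓ)`-labelled for every `lam ≥ 0`, `ℓ`
  (identity labelling), so the new binder SUBSUMES the labelling binder (kept for verbatim dials);
* §R2 ★ `LocalSeamTransferBoundB` (H𝄪ᴮ) := (H𝄪ˢ) with the extra binder — WEAKER than (H𝄪ˢ) (`localSeamTransferBoundB_of_S`, hence than (H𝄪ʳ));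
  ★ `LocalSeamReductionB` (N𝄪ᴮ) := (H𝄪ᴮ) → leaf — STRONGER than (N𝄪ˢ) (`localSeamReductionS_of_B`), WEAKER than the leaf
  (`localSeamReductionB_of_budget`); glue `farLabelledFloorCoredBudgetW_of_localB` (modus ponens); monotonicity in `μ₀`, `C_T`, `Cχ`;
* §R3 ★★ record cones `chargedEnergyGap_of_localLedgerB` (any `ϱ`, any weight system) and `chargedEnergyGap_of_maxCoverLocalLedgerB_record`
  (`ϱ = 160`, THE RECORD-DESIGNATE OF GENERATION 64): ten leaves ⟹ `ChargedEnergyGap`, kernel-checked;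
* §R4 the rotation sub-family `RotationFamilyB` (⟸ (H𝄪ᴮ) by specialisation; ⟸ `RotationFamilyS`), the residual ★ `BulkFarResidueBoundB s lam ℓ μ₀
  ϱ ϱχ B_T B_χ B_H` (the bulk far-residue bound demanded only of (H𝄪ᴮ)'s references; ⟸ `BulkFarResidueBoundSF`), and ★★ `rotationFamilyB_of_bulkB`
  — the chain P-X/P-Y/P-Z₃ pointwise (its three lemmas use only separation, invariance and site-stress-freeness) — with the record instance
  `rotationFamilyB_record_of_bulkBoundB`: `BulkFarResidueBoundB (3/5) (1/3) 3 (1/100) 160 80 (1/2100) (1/46) B_H ⟹ RotationFamilyB (record)`;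
* §R5 ★★ THE WITNESS: `Fcc.nine_tenths_le_a0_sqrt2` — the Lennard-Jones fcc equilibrium spacing satisfies `9/10 ≤ a₀√2` (from the certified
  Epstein-sum window `491/5000 ≤ a₀⁶`, `…StabilityNumerics.le_pow_six`; numerically `a₀√2 ≈ 0.9712`), so `Fcc.isBarlowImage_fccRef_a0`: the P-L
  witness `fccRef a₀` IS a Barlow image, and `hypothesisBlockB_record_inhabited`: the six-hypothesis block of (H𝄪ᴮ) at the record dials is inhabited
  (separated `3/5`, labelled `(1/3, 3)`, Barlow image, force-free, site-stress-free, `HarmStableModRot (1/100)`);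
* §R6 ★ `TubeLoad` / `TubeLoadBound s r a₀ b₀ K` — THE PER-SITE PASS-LOAD (critic row 1191 P-Z₅c (i)×(ii), scheme-independent part): for a site
  `c`, finite source / target sets at distances `≥ a₀` / `≥ b₀` from `c`, the kernel mass `Σ |y − z|⁻⁶` of the pairs whose segment passes within
  `r` of `c`; stated as a `Prop`-valued bound over separated Barlow-image references (no constant asserted here; the table of memo g64 §1 names
  the candidates `K ≈ 4π²r²ρ²/(6(a₀+b₀)²)`), with its monotonicity.  The share / budget comparison (iii) is scheme-dependent and is P-Z₅d's;
* §R7 ★ THE SHADOW LEMMAS `tube_shadow` / `tube_shadow_ball` (Euclidean half of the tube-load lemma P-Z₅c′): if `[y, z]` passes within `r` of `c`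
  and `dist y c = a > r`, `dist z c = b`, then `z` lies within `r(a+b)/(a−r)` of the ray from `c` away from `y` (parameter window
  `[(b−r)/(a+r), (b+r)/(a−r)]`), hence in the closed ball of radius `2r(a+b)/(a−r)` about `c + (b/a)•(c − y)` — what the Barlow ball counts sum over.

COST TO THE PARTNER (N𝄪ᴮ) versus (N𝄪ˢ): NIL beyond typing — (N𝄪ˢ)'s proof obligations (part P-I(2/2), `…SiteStressFreeA` §N1 docstring) already
chart all far matter on fcc(`a₀`) / hcp(`a*, h*`) supercells plus complete coherent seams, whose point sets ARE Barlow images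
(`Fcc.isBarlowImage_fccRef_a0` below; `isBarlowImage_barlowStacking` for hcp, window `[9/10, 11/10] × [0.66a, 0.90a]` to be met by `(a*, h*)` —
the same equilibrium-window obligation «STAB-k» the (R2) pair already owes).  GAIN: the residual's reference is an isometric copy of an explicit
`barlowStacking a h s`: density, separation (`≥ min(a, √(a²/3 + h²)) ≥ 0.83`), covering radius and layer coordinates are certified constants,
and the labelled-patch floor `109 / 6.19-ball` is replaced by exact counts.
-/

noncomputable section

open scoped Classical
open Literature.MathematicalPhysics.StatisticalMechanics Literature.Geometry.DiscreteGeometry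
open Summit.AtomisticToContinuum.Crystallization.Theses.PricedLinkCensus
open Summit.AtomisticToContinuum.Crystallization.Theorems.ChargedEnergyGapNegative

namespace Summit.AtomisticToContinuum.Crystallization.Theorems.ChargedEnergyGapChartDial

/-! ## §R1 Barlow images are labelled references (identity labelling) -/

section BarlowLabelled

/-- A configuration whose point set is a Barlow image is `(lam, ℓ)`-labelled at every one of its points, for every `lam ≥ 0` and every `ℓ`:
take the image itself as label set and the identity as label map. -/
theorem labelledWithin_of_isBarlowImage {P : PeriodicConfiguration 3} (hB : IsBarlowImage P.points) {lam : ℝ} (ℓ : ℝ) (hlam : 0 ≤ lam)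
    {p : E3} (hp : p ∈ P.points) : LabelledWithin lam ℓ P p := by
  refine ⟨P.points, hB, id, p, hp, rfl, fun x hx _ => hx, fun q hq hqp => ⟨q, hq, ?_, rfl⟩, fun x _ x' _ _ _ => ?_⟩
  · have := dist_nonneg (x := q) (y := p)
    linarith
  · simp only [id, sub_self, norm_zero]
    exact mul_nonneg hlam (norm_nonneg _)

/-- ★ A Barlow-image reference is a `(lam, ℓ)`-labelled reference for every `lam ≥ 0`, `ℓ`: the binder `IsBarlowImage P.points` subsumes
`IsLabelledRef lam ℓ P`. -/
theorem isLabelledRef_of_isBarlowImage {P : PeriodicConfiguration 3} (hB : IsBarlowImage P.points) {lam : ℝ} (ℓ : ℝ) (hlam : 0 ≤ lam) :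
    IsLabelledRef lam ℓ P :=
  fun _ hy => labelledWithin_of_isBarlowImage hB ℓ hlam (P.mem_points_of_mem_motif hy)

end BarlowLabelled

/-! ## §R2 ★ The (R3) re-typed designate pair (H𝄪ᴮ)/(N𝄪ᴮ) -/

section PairB

variable (s lam ℓ μ₀ τ lamQ ϱ b₀ r_S C_T ϱχ Cχ : ℝ)

/-- piece LOCAL-TRANSFERᴮ(`C_T`, `Cχ`, `ϱχ`) · **THE (R3) RE-TYPED (H𝄪ˢ)**: the localised seam transfer bound VERBATIM (twelve dials, conclusion),
with ONE MORE binder on the reference, `IsBarlowImage P.points` (the reference point set is an isometric image of a Barlow stacking with lattice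
constant `a ∈ [9/10, 11/10]` and layer spacing `h`, `27a²/50 ≤ h² ≤ 121a²/150`) · WEAKER than (H𝄪ˢ) (`localSeamTransferBoundB_of_S`) ·
UNDECIDED→TRUE-leaning at the record (as (H𝄪ˢ): ROT-OSC void without excision, complete seam stacks invisible; the rotation instances reduce to
`BulkFarResidueBoundB`, §R4) · INSTRUMENTABLE · ATTACKABLE-M.  Why it might fail: as (H𝄪ˢ) — an excised-collar geometry beating the charging
budgets `(C_T, Cχ) = (1/(3·10⁶), 10⁻⁵)` of a genuine strain field; the Barlow binder removes only the non-physical density-contrast instances. -/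
def LocalSeamTransferBoundB : Prop :=
  ∃ C_H : ℝ, 0 ≤ C_H ∧ ∀ (P : PeriodicConfiguration 3) (C X : Set E3) (β₀ : E3 → E3 → E3) (k : ℕ) (S : Fin k → CutPiece)
    (m : ℕ) (D : Fin m → Set E3) (σ : Fin m → Bool),
    IsSeparatedRef s P → IsLabelledRef lam ℓ P → IsBarlowImage P.points → IsForceFree P → IsSiteStressFree P → HarmStableModRot μ₀ P →
    IsInvariantSet P C → IsInvariantSet P X → IsGlobalCocycle P β₀ → IsSeamSystem b₀ r_S P S →
    SmallStrain τ P X (volterraField P S β₀) → (∀ i, IsInvariantSet P (D i)) →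
      -(C_T * shellMassL ϱχ D σ P X ϱ C) - Cχ * transMassL ϱχ D σ P X ϱ C - C_H * (pricedNearCountL ϱχ D σ P X ϱ C : ℝ) ≤
        modelFarL ϱχ D σ (volterraField P S β₀) P X lamQ ϱ C

variable {s lam ℓ μ₀ τ lamQ ϱ b₀ r_S C_T ϱχ Cχ}

/-- ★ **(H𝄪ˢ) ⟹ (H𝄪ᴮ)**: the re-typed piece serves FEWER references (one more hypothesis). -/
theorem localSeamTransferBoundB_of_S (h : LocalSeamTransferBoundS s lam ℓ μ₀ τ lamQ ϱ b₀ r_S C_T ϱχ Cχ) :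
    LocalSeamTransferBoundB s lam ℓ μ₀ τ lamQ ϱ b₀ r_S C_T ϱχ Cχ := by
  obtain ⟨C_H, hH, h⟩ := h
  exact ⟨C_H, hH, fun P C X β₀ k S m D σ h1 h2 _ h3 h4 h5 h6 h7 h8 h9 h10 h11 =>
    h P C X β₀ k S m D σ h1 h2 h3 h4 h5 h6 h7 h8 h9 h10 h11⟩

/-- (H𝄪ʳ) ⟹ (H𝄪ᴮ) (through (H𝄪ˢ)). -/
theorem localSeamTransferBoundB_of_R (h : LocalSeamTransferBoundR s lam ℓ μ₀ τ lamQ ϱ b₀ r_S C_T ϱχ Cχ) :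
    LocalSeamTransferBoundB s lam ℓ μ₀ τ lamQ ϱ b₀ r_S C_T ϱχ Cχ :=
  localSeamTransferBoundB_of_S (localSeamTransferBoundS_of_R h)

/-- (H𝄪ᴮ) is monotone in the stability margin it assumes … -/
theorem LocalSeamTransferBoundB.mono_mu {μ₀' : ℝ} (hμ : μ₀ ≤ μ₀') (h : LocalSeamTransferBoundB s lam ℓ μ₀ τ lamQ ϱ b₀ r_S C_T ϱχ Cχ) :
    LocalSeamTransferBoundB s lam ℓ μ₀' τ lamQ ϱ b₀ r_S C_T ϱχ Cχ := by
  obtain ⟨C_H, hH, h⟩ := h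
  exact ⟨C_H, hH, fun P C X β₀ k S m D σ h1 h2 hb h3 h4 h5 h6 h7 h8 h9 h10 h11 =>
    h P C X β₀ k S m D σ h1 h2 hb h3 h4 (h5.anti hμ) h6 h7 h8 h9 h10 h11⟩

/-- … in the transfer constant `C_T` … -/
theorem LocalSeamTransferBoundB.mono_CT {C_T' : ℝ} (hC : C_T ≤ C_T') (h : LocalSeamTransferBoundB s lam ℓ μ₀ τ lamQ ϱ b₀ r_S C_T ϱχ Cχ) :
    LocalSeamTransferBoundB s lam ℓ μ₀ τ lamQ ϱ b₀ r_S C_T' ϱχ Cχ := by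
  obtain ⟨C_H, hH, h⟩ := h
  refine ⟨C_H, hH, fun P C X β₀ k S m D σ h1 h2 hb h3 h4 h5 h6 h7 h8 h9 h10 h11 =>
    le_trans ?_ (h P C X β₀ k S m D σ h1 h2 hb h3 h4 h5 h6 h7 h8 h9 h10 h11)⟩
  have := shellMassL_nonneg (ϱχ := ϱχ) (D := D) (σ := σ) P X ϱ C
  nlinarith

/-- … and in the transition constant `Cχ`. -/
theorem LocalSeamTransferBoundB.mono_Cchi {Cχ' : ℝ} (hC : Cχ ≤ Cχ') (h : LocalSeamTransferBoundB s lam ℓ μ₀ τ lamQ ϱ b₀ r_S C_T ϱχ Cχ) :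
    LocalSeamTransferBoundB s lam ℓ μ₀ τ lamQ ϱ b₀ r_S C_T ϱχ Cχ' := by
  obtain ⟨C_H, hH, h⟩ := h
  refine ⟨C_H, hH, fun P C X β₀ k S m D σ h1 h2 hb h3 h4 h5 h6 h7 h8 h9 h10 h11 =>
    le_trans ?_ (h P C X β₀ k S m D σ h1 h2 hb h3 h4 h5 h6 h7 h8 h9 h10 h11)⟩
  have := transMassL_nonneg (ϱχ := ϱχ) (D := D) (σ := σ) P X ϱ C
  nlinarith

variable (s lam ℓ μ₀ τ lamQ ϱ b₀ r_S C_T ϱχ Cχ)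
variable {θ ε R r η L δ L' : ℝ} (W : CoreWeights θ ε R r η L δ L' ϱ) (c₁ ρ₀ B₀ : ℝ)

/-- piece LOCAL-REDUCTIONᴮ_W · **THE (R3) RE-TYPED (N𝄪ˢ)**: the re-typed transfer bound implies the budget far leaf · STRONGER than (N𝄪ˢ)
(`localSeamReductionS_of_B`), WEAKER than the leaf (`localSeamReductionB_of_budget`) · UNDECIDED (TRUE-leaning with the leaf for the max cover) ·
ATTACKABLE-L.  Proof obligations: exactly those of (N𝄪ˢ) (every reference handed to the transfer piece is an fcc(`a₀`) or hcp(`a*, h*`) supercell plus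
complete coherent seams absorbed into the base cocycle), PLUS the check that these point sets are Barlow images with parameters in the window —
`Fcc.isBarlowImage_fccRef_a0` (§R5) for fcc; `isBarlowImage_barlowStacking` with `(a*, h*) ∈ [9/10, 11/10] × [0.66a*, 0.90a*]` for hcp (part of the
equilibrium-window obligation «STAB-k» already owed). -/
def LocalSeamReductionB : Prop :=
  LocalSeamTransferBoundB s lam ℓ μ₀ τ lamQ ϱ b₀ r_S C_T ϱχ Cχ → FarLabelledFloorCoredBudgetW W c₁ s ρ₀ lam ℓ B₀

variable {s lam ℓ μ₀ τ lamQ ϱ b₀ r_S C_T ϱχ Cχ W c₁ ρ₀ B₀}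

/-- ★ **THE SPLIT** (glue, proved; bridge split by modus ponens): LOCAL-TRANSFERᴮ ∧ LOCAL-REDUCTIONᴮ_W ⟹ CB-FAR_W|cored,`B₀`. -/
theorem farLabelledFloorCoredBudgetW_of_localB (hS : LocalSeamTransferBoundB s lam ℓ μ₀ τ lamQ ϱ b₀ r_S C_T ϱχ Cχ)
    (hN : LocalSeamReductionB s lam ℓ μ₀ τ lamQ ϱ b₀ r_S C_T ϱχ Cχ W c₁ ρ₀ B₀) : FarLabelledFloorCoredBudgetW W c₁ s ρ₀ lam ℓ B₀ :=
  hN hS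

/-- ★ STRONGER: (N𝄪ᴮ) ⟹ (N𝄪ˢ) (the reduction's hypothesis got weaker). -/
theorem localSeamReductionS_of_B (h : LocalSeamReductionB s lam ℓ μ₀ τ lamQ ϱ b₀ r_S C_T ϱχ Cχ W c₁ ρ₀ B₀) :
    LocalSeamReductionS s lam ℓ μ₀ τ lamQ ϱ b₀ r_S C_T ϱχ Cχ W c₁ ρ₀ B₀ :=
  fun hS => h (localSeamTransferBoundB_of_S hS)

/-- (N𝄪ᴮ) ⟹ (N𝄪ʳ). -/
theorem localSeamReductionR_of_B (h : LocalSeamReductionB s lam ℓ μ₀ τ lamQ ϱ b₀ r_S C_T ϱχ Cχ W c₁ ρ₀ B₀) :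
    LocalSeamReductionR s lam ℓ μ₀ τ lamQ ϱ b₀ r_S C_T ϱχ Cχ W c₁ ρ₀ B₀ :=
  localSeamReductionR_of_S (localSeamReductionS_of_B h)

/-- WEAKER than the leaf: CB-FAR_W|cored,`B₀` ⟹ (N𝄪ᴮ). -/
theorem localSeamReductionB_of_budget (h : FarLabelledFloorCoredBudgetW W c₁ s ρ₀ lam ℓ B₀) :
    LocalSeamReductionB s lam ℓ μ₀ τ lamQ ϱ b₀ r_S C_T ϱχ Cχ W c₁ ρ₀ B₀ :=
  fun _ => h

/-- (N𝄪ᴮ) is antitone in the stability margin … -/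
theorem LocalSeamReductionB.anti_mu {μ₀' : ℝ} (hμ : μ₀ ≤ μ₀') (h : LocalSeamReductionB s lam ℓ μ₀' τ lamQ ϱ b₀ r_S C_T ϱχ Cχ W c₁ ρ₀ B₀) :
    LocalSeamReductionB s lam ℓ μ₀ τ lamQ ϱ b₀ r_S C_T ϱχ Cχ W c₁ ρ₀ B₀ :=
  fun hS => h (hS.mono_mu hμ)

/-- … in `C_T` … -/
theorem LocalSeamReductionB.anti_CT {C_T' : ℝ} (hC : C_T ≤ C_T') (h : LocalSeamReductionB s lam ℓ μ₀ τ lamQ ϱ b₀ r_S C_T' ϱχ Cχ W c₁ ρ₀ B₀) :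
    LocalSeamReductionB s lam ℓ μ₀ τ lamQ ϱ b₀ r_S C_T ϱχ Cχ W c₁ ρ₀ B₀ :=
  fun hS => h (hS.mono_CT hC)

/-- … and in `Cχ`. -/
theorem LocalSeamReductionB.anti_Cchi {Cχ' : ℝ} (hC : Cχ ≤ Cχ') (h : LocalSeamReductionB s lam ℓ μ₀ τ lamQ ϱ b₀ r_S C_T ϱχ Cχ' W c₁ ρ₀ B₀) :
    LocalSeamReductionB s lam ℓ μ₀ τ lamQ ϱ b₀ r_S C_T ϱχ Cχ W c₁ ρ₀ B₀ :=
  fun hS => h (hS.mono_Cchi hC)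

end PairB

/-! ## §R3 ★★ Record cones over the (R3) pieces -/

section RecordB

/-- ★★ **THE TEN-LEAF RECORD CONE FOR EVERY WEIGHT SYSTEM, (R3)-RE-TYPED**: `ChargeRecount · IP_G · FCP_G · CCP_G · REG-BALL_W · LABEL_W ·
SHELL-BUDGET_W(10⁵) · LOCAL-TRANSFERᴮ(1/(3·10⁶), 10⁻⁵, 80) · LOCAL-REDUCTIONᴮ_W · P_G ⟹ ChargedEnergyGap` at the record dials, any `ϱ`, any `W`. -/
theorem chargedEnergyGap_of_localLedgerB {ϱ : ℝ} (W : CoreWeights (3 / 20) (1 / 10) (6 / 5) 10 (1 / 100) 40 (1 / 10) 40 ϱ)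
    (hF : ChargeRecount)
    (hIP : ImprovablePricingG (3 / 20) (1 / 10) (6 / 5) 10 (1 / 100) (3 / 5))
    (hFCP : FrustratedCorePricingG (3 / 20) (1 / 10) (6 / 5) 10 (1 / 100) 40 (3 / 5))
    (hCCP : CoherentCorePricingG (3 / 20) (1 / 10) (6 / 5) 10 (1 / 100) 40 (1 / 10) 40 (3 / 5))
    (hB : CoreBallRegularPricingW W (1 / 20) (3 / 5) 10 fun _ _ => True)
    (hLab : CleanLabellingW W (3 / 5) 10 (1 / 3) 3)
    (hSB : ShellBudgetW W (3 / 5) 100000)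
    (hS : LocalSeamTransferBoundB (3 / 5) (1 / 3) 3 (1 / 100) (3 / 100) (1 / 2) ϱ (2 / 5) 3 (1 / 3000000) 80 (1 / 100000))
    (hN : LocalSeamReductionB (3 / 5) (1 / 3) 3 (1 / 100) (3 / 100) (1 / 2) ϱ (2 / 5) 3 (1 / 3000000) 80 (1 / 100000) W (1 / 20) 10
      100000)
    (hP : ChartedChargePricingG (3 / 20) (1 / 10) (3 / 5)) : ChargedEnergyGap :=
  chargedEnergyGap_of_budgetLedger W hF hIP hFCP hCCP hB hLab hSB (farLabelledFloorCoredBudgetW_of_localB hS hN) hP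

/-- ★★ **THE MAX-COVER TEN-LEAF RECORD CONE, (R3)-RE-TYPED** at `ϱ = 160` — THE RECORD-DESIGNATE OF GENERATION 64: `ChargeRecount · IP_G · FCP_G ·
CCP_G · REG-BALL_M · LABEL_M · SHELL-BUDGET_M(10⁵) · LOCAL-TRANSFERᴮ(1/(3·10⁶), 10⁻⁵, 80) · LOCAL-REDUCTIONᴮ_M · P_G ⟹ ChargedEnergyGap`. -/
theorem chargedEnergyGap_of_maxCoverLocalLedgerB_record (hF : ChargeRecount)
    (hIP : ImprovablePricingG (3 / 20) (1 / 10) (6 / 5) 10 (1 / 100) (3 / 5))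
    (hFCP : FrustratedCorePricingG (3 / 20) (1 / 10) (6 / 5) 10 (1 / 100) 40 (3 / 5))
    (hCCP : CoherentCorePricingG (3 / 20) (1 / 10) (6 / 5) 10 (1 / 100) 40 (1 / 10) 40 (3 / 5))
    (hB : CoreBallRegularPricingW (maxCoverWeights (3 / 20) (1 / 10) (6 / 5) 10 (1 / 100) 40 (1 / 10) 40 160) (1 / 20) (3 / 5) 10
      fun _ _ => True)
    (hLab : CleanLabellingW (maxCoverWeights (3 / 20) (1 / 10) (6 / 5) 10 (1 / 100) 40 (1 / 10) 40 160) (3 / 5) 10 (1 / 3) 3)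
    (hSB : ShellBudgetW (maxCoverWeights (3 / 20) (1 / 10) (6 / 5) 10 (1 / 100) 40 (1 / 10) 40 160) (3 / 5) 100000)
    (hS : LocalSeamTransferBoundB (3 / 5) (1 / 3) 3 (1 / 100) (3 / 100) (1 / 2) 160 (2 / 5) 3 (1 / 3000000) 80 (1 / 100000))
    (hN : LocalSeamReductionB (3 / 5) (1 / 3) 3 (1 / 100) (3 / 100) (1 / 2) 160 (2 / 5) 3 (1 / 3000000) 80 (1 / 100000)
      (maxCoverWeights (3 / 20) (1 / 10) (6 / 5) 10 (1 / 100) 40 (1 / 10) 40 160) (1 / 20) 10 100000)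
    (hP : ChartedChargePricingG (3 / 20) (1 / 10) (3 / 5)) : ChargedEnergyGap :=
  chargedEnergyGap_of_maxCoverBudgetLedger_record hF hIP hFCP hCCP hB hLab hSB (farLabelledFloorCoredBudgetW_of_localB hS hN) hP

/-- Consistency: a proof of the generation-62/63 pair (H𝄪ˢ)/(N𝄪ᴮ) feeds the g64 cone ((H𝄪ˢ) into the weaker transfer slot). -/
theorem chargedEnergyGap_of_maxCoverLocalLedgerB_of_S (hF : ChargeRecount)
    (hIP : ImprovablePricingG (3 / 20) (1 / 10) (6 / 5) 10 (1 / 100) (3 / 5))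
    (hFCP : FrustratedCorePricingG (3 / 20) (1 / 10) (6 / 5) 10 (1 / 100) 40 (3 / 5))
    (hCCP : CoherentCorePricingG (3 / 20) (1 / 10) (6 / 5) 10 (1 / 100) 40 (1 / 10) 40 (3 / 5))
    (hB : CoreBallRegularPricingW (maxCoverWeights (3 / 20) (1 / 10) (6 / 5) 10 (1 / 100) 40 (1 / 10) 40 160) (1 / 20) (3 / 5) 10
      fun _ _ => True)
    (hLab : CleanLabellingW (maxCoverWeights (3 / 20) (1 / 10) (6 / 5) 10 (1 / 100) 40 (1 / 10) 40 160) (3 / 5) 10 (1 / 3) 3)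
    (hSB : ShellBudgetW (maxCoverWeights (3 / 20) (1 / 10) (6 / 5) 10 (1 / 100) 40 (1 / 10) 40 160) (3 / 5) 100000)
    (hS : LocalSeamTransferBoundS (3 / 5) (1 / 3) 3 (1 / 100) (3 / 100) (1 / 2) 160 (2 / 5) 3 (1 / 3000000) 80 (1 / 100000))
    (hN : LocalSeamReductionB (3 / 5) (1 / 3) 3 (1 / 100) (3 / 100) (1 / 2) 160 (2 / 5) 3 (1 / 3000000) 80 (1 / 100000)
      (maxCoverWeights (3 / 20) (1 / 10) (6 / 5) 10 (1 / 100) 40 (1 / 10) 40 160) (1 / 20) 10 100000)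
    (hP : ChartedChargePricingG (3 / 20) (1 / 10) (3 / 5)) : ChargedEnergyGap :=
  chargedEnergyGap_of_maxCoverLocalLedgerB_record hF hIP hFCP hCCP hB hLab hSB (localSeamTransferBoundB_of_S hS) hN hP

end RecordB

end Summit.AtomisticToContinuum.Crystallization.Theorems.ChargedEnergyGapChartDial

end
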